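import Literature.AlgebraicTopology.Homotopy.SerreFibrationFibrewiseScalarDimOne
import HarnessLib

/-!
# A fibrewise endomorphism acting as a scalar on the fibres: exhausted bases and the cohomological form

Topic `Literature/AlgebraicTopology/Homotopy`. PROOF FILE (theorems only; no definition, no named fact). Sequel of
`SerreFibrationFibrewiseScalarDimOne` (the case of a Hausdorff CW base without cells of dimension `> 1`). For a Serre
fibration `p : E → B`, a field `K` and a map `ν : E → E` over `B` acting as the scalar `c` on `Hₙ(p⁻¹b; K)` of every
fibre:

* `SerreFibrewiseScalar.sub_smul_mem_of_cells_le_one` — over a base weakly equivalent to a Hausdorff CW complex without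
  cells of dimension `> 1`, `ν_* α - c·α` is a sum of classes of fibres for every `α ∈ H_{n+1}(E; K)` (pull back to
  the CW model: `h^*E → E` is a weak equivalence, Spanier 9.2.17, and `ν` lifts);
* `…_piece_of_cells_le_one`, `…_of_exhaustion` — the same over a sub-base with such a CW model and over a base
  exhausted by open sets inside such pieces (singular homology has compact supports, Hatcher Prop. 3.33) — the form met
  by the complex points of a smooth affine curve (Andreotti–Frankel);
* `SerreFibrewiseScalar.map_eq_smul_of_forall_res_eq_zero_of_exhaustion` — **cohomological form**: a class
  `z ∈ H^{n+1}(E; K)` vanishing on every fibre satisfies `ν^* z = c·z` as soon as `ν^*` acts as `c` on `Hⁿ` of every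
  fibre (Kronecker duality over the field, Hatcher Thm. 3.2). In terms of the Leray spectral sequence: `ν` acts on
  `E_∞^{1,n} = H¹(B; Rⁿ p_* K) = L¹H^{n+1}(E)` through its (scalar) action on the coefficients (Voisin II §4.2.3).

Consumer: the Leray weights of the multiplication `θ_N` of an abelian scheme over a punctured curve (Hodge summit,
Ring 2, André axis part XXV).

## References

* C. Voisin, *Hodge Theory and Complex Algebraic Geometry II*, CUP (2003), §4.2.3, Thm. 4.15, §4.3.1. [VoisinHodgeII2003]
* A. Hatcher, *Algebraic Topology*, CUP (2002), §2.2 pp. 149–150, §3.1 Thm. 3.2 (p. 198), p. 201, Prop. 3.33.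
  [HatcherAT2002]
* E. H. Spanier, *Algebraic Topology*, Springer (1981), Ch. 9 Sec. 2 Thm. 17. [Spanier1981]
-/

noncomputable section

open Set Function Metric CategoryTheory
open scoped Topology unitInterval
open Literature.AlgebraicTopology.SingularHomology Literature.Algebra.Homology

namespace Literature.AlgebraicTopology.Homotopy

universe u

namespace SerreFibrewiseScalar

open _root_.Topology RelCWComplex SerreFlat

/-! ### Over a base of the weak homotopy type of a CW complex without cells of dimension `> 1` -/

section General

variable (K : Type u) [Field K]
variable {B : Type u} [TopologicalSpace B] {E : Type u} [TopologicalSpace E] {p : E → B}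
  (hp : IsSerreFibration p) (ν : C(E, E)) (hν : ∀ e, p (ν e) = p e) {n : ℕ} {c : K}
  (hνF : ∀ (b : B) (νb : C(↥(p ⁻¹' {b}), ↥(p ⁻¹' {b}))), (∀ e, (νb e : E) = ν e) →
    ∀ y : singularHomology K K ↥(p ⁻¹' {b}) n, singularHomology.map K K νb n y = c • y)
  {X : Type u} [TopologicalSpace X] [T2Space X] [CWComplex (univ : Set X)]
  (h : C(X, B)) (hh : IsWeakHomotopyEquiv h)

include hνF in
/-- `sub_smul_mem_cw_of_cells_le_one` with the pullback `h^*E → X` abstracted: any Serre fibration `p' : E' → X`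
with a weak equivalence `snd : E' → E` identifying the fibres over `x` and `h x` and a lift `ν'` of `ν` (verbatim the
reduction `SerreInvariantCycles.exists_class_of_flat_aux_of_cells_le_one`, in homology). [cite: Spanier1981, Ch. 9, Sec. 2, Thm. 17]
[cite: HatcherAT2002, §2.2 pp. 149–150] -/
theorem sub_smul_mem_aux_of_cells_le_one {E' : Type u} [TopologicalSpace E'] {p' : E' → X}
    (hp' : IsSerreFibration p') (snd : C(E', E)) (hsnd : IsWeakHomotopyEquiv snd)
    (ν' : C(E', E')) (hν' : ∀ e, p' (ν' e) = p' e)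
    (hsndν : ∀ e, snd (ν' e) = ν (snd e))
    (φ : ∀ x : X, ↥(p' ⁻¹' {x}) ≃ₜ ↥(p ⁻¹' {h x}))
    (hφ : ∀ (x : X) (e : ↥(p' ⁻¹' {x})), ((φ x e : ↥(p ⁻¹' {h x})) : E) = snd e.1)
    (h1 : ∀ m, 1 < m → IsEmpty (cell (univ : Set X) m)) (α : singularHomology K K E (n + 1)) :
    singularHomology.map K K ν (n + 1) α - c • α ∈
      ⨆ b : B, LinearMap.range (singularHomology.map K K (subsetIncl (p ⁻¹' {b})) (n + 1)).hom := by
  have hφfac : ∀ x : X, snd.comp (subsetIncl (p' ⁻¹' {x})) =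
      (subsetIncl (p ⁻¹' {h x})).comp (φ x : C(↥(p' ⁻¹' {x}), ↥(p ⁻¹' {h x}))) :=
    fun x => ContinuousMap.ext fun e => (hφ x e).symm
  -- the fibre hypothesis on `E'`
  have hνF' : ∀ (x : X) (νx : C(↥(p' ⁻¹' {x}), ↥(p' ⁻¹' {x}))), (∀ e, (νx e : E') = ν' e) →
      ∀ y : singularHomology K K ↥(p' ⁻¹' {x}) n, singularHomology.map K K νx n y = c • y := by
    intro x νx hνx y
    -- transport `νx` to the fibre of `p` over `h x`
    let νb : C(↥(p ⁻¹' {h x}), ↥(p ⁻¹' {h x})) :=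
      ((φ x : C(↥(p' ⁻¹' {x}), ↥(p ⁻¹' {h x}))).comp νx).comp ((φ x).symm : C(↥(p ⁻¹' {h x}), ↥(p' ⁻¹' {x})))
    have hνb : ∀ e, (νb e : E) = ν e := fun e => by
      change ((φ x (νx ((φ x).symm e)) : ↥(p ⁻¹' {h x})) : E) = ν e
      rw [hφ x, hνx, hsndν, ← hφ x, Homeomorph.apply_symm_apply]
    refine map_eq_smul_of_homeomorph K (φ x) νx νb (fun e => ?_) (hνF (h x) νb hνb) y
    change φ x (νx e) = φ x (νx ((φ x).symm (φ x e)))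
    rw [Homeomorph.symm_apply_apply]
  -- the theorem over the CW base, pushed forward along `snd`
  haveI := isIso_singularHomology_map_of_isWeakHomotopyEquiv K snd hsnd (n + 1)
  obtain ⟨α', rfl⟩ := (bijective_hom_of_isIso (singularHomology.map K K snd (n + 1))).2 α
  have key := sub_smul_mem_cw_of_cells_le_one K hp' ν' hν' hνF' h1 α'
  have hcomm : snd.comp ν' = ν.comp snd := ContinuousMap.ext hsndν
  have hpush : singularHomology.map K K ν (n + 1) ((singularHomology.map K K snd (n + 1)).hom α') - c •
      (singularHomology.map K K snd (n + 1)).hom α' =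
      singularHomology.map K K snd (n + 1) (singularHomology.map K K ν' (n + 1) α' - c • α') := by
    rw [map_sub, map_smul, ← ModuleCat.comp_apply, ← singularHomology.map_comp, ← hcomm, singularHomology.map_comp,
      ModuleCat.comp_apply]
  rw [hpush]
  refine Submodule.iSup_induction (p := fun x : X => LinearMap.range (singularHomology.map K K (subsetIncl (p' ⁻¹' {x})) (n + 1)).hom)
    (motive := fun w => singularHomology.map K K snd (n + 1) w ∈
      ⨆ b : B, LinearMap.range (singularHomology.map K K (subsetIncl (p ⁻¹' {b})) (n + 1)).hom) key ?_ ?_ ?_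
  · rintro x w ⟨y, rfl⟩
    refine Submodule.mem_iSup_of_mem (h x) ⟨singularHomology.map K K (φ x : C(↥(p' ⁻¹' {x}), ↥(p ⁻¹' {h x}))) (n + 1) y, ?_⟩
    change singularHomology.map K K (subsetIncl (p ⁻¹' {h x})) (n + 1)
      (singularHomology.map K K (φ x : C(↥(p' ⁻¹' {x}), ↥(p ⁻¹' {h x}))) (n + 1) y) =
      singularHomology.map K K snd (n + 1) (singularHomology.map K K (subsetIncl (p' ⁻¹' {x})) (n + 1) y)
    rw [← ModuleCat.comp_apply, ← singularHomology.map_comp, ← hφfac x, singularHomology.map_comp, ModuleCat.comp_apply]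
  · rw [map_zero]; exact Submodule.zero_mem _
  · intro w w' hw hw'
    rw [map_add]; exact Submodule.add_mem _ hw hw'

include hp hν hνF hh in
/-- **Over a base weakly equivalent to a Hausdorff CW complex without cells of dimension `> 1`, a map over the base
acting as `c` on `Hₙ` of every fibre acts as `c` on `H_{n+1}(E)` modulo classes of fibres** (pull back to the CW model:
`h^*E → E` is a weak equivalence, Spanier 9.2.17; `ν` lifts to `h^*E`). [cite: Spanier1981, Ch. 9, Sec. 2, Thm. 17]
[cite: HatcherAT2002, §2.2 pp. 149–150] -/
theorem sub_smul_mem_of_cells_le_one (h1 : ∀ m, 1 < m → IsEmpty (cell (univ : Set X) m))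
    (α : singularHomology K K E (n + 1)) :
    singularHomology.map K K ν (n + 1) α - c • α ∈
      ⨆ b : B, LinearMap.range (singularHomology.map K K (subsetIncl (p ⁻¹' {b})) (n + 1)).hom := by
  have hp' : IsSerreFibration (Function.Pullback.fst : (⇑h).Pullback p → X) := hp.pullback_fst h
  have hsnd := hp.isWeakHomotopyEquiv_pullback_snd h hh
  have hmemφ : ∀ (x : X) (e : ↥((Function.Pullback.fst : (⇑h).Pullback p → X) ⁻¹' {x})),
      e.1.snd ∈ p ⁻¹' {h x} := fun x e => by
    have he : e.1.fst = x := e.2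
    have h2 : h e.1.fst = p e.1.snd := e.1.2
    rw [he] at h2
    exact h2.symm
  -- the lift of `ν` to the pullback
  have hν'w : ∀ q : (⇑h).Pullback p, h q.fst = p (ν q.snd) := fun q => by rw [hν]; exact q.2
  let ν' : C((⇑h).Pullback p, (⇑h).Pullback p) :=
    ⟨fun q => ⟨(q.fst, ν q.snd), hν'w q⟩,
      ((continuous_fst.comp continuous_subtype_val).prodMk
        (ν.continuous.comp (continuous_snd.comp continuous_subtype_val))).subtype_mk hν'w⟩
  refine sub_smul_mem_aux_of_cells_le_one K ν hνF h hp' _ hsnd ν' (fun _ => rfl) (fun _ => rfl)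
    (fun x =>
      { toFun := fun e => ⟨e.1.snd, hmemφ x e⟩
        invFun := fun e => ⟨⟨(x, e.1), (e.2 : p e.1 = h x).symm⟩, rfl⟩
        left_inv := fun e => by
          apply Subtype.ext; apply Subtype.ext; apply Prod.ext
          · exact (e.2 : e.1.fst = x).symm
          · rfl
        right_inv := fun e => rfl
        continuous_toFun :=
          ((continuous_snd.comp continuous_subtype_val).comp continuous_subtype_val).subtype_mk _
        continuous_invFun := ((continuous_const.prodMk continuous_subtype_val).subtype_mk _).subtype_mk _ })
    (fun x e => rfl) h1 α

end General

/-! ### Over a sub-base with such a CW model -/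

section Piece

variable (K : Type u) [Field K]
variable {B : Type u} [TopologicalSpace B] {E : Type u} [TopologicalSpace E] {p : E → B}
  (hp : IsSerreFibration p) (ν : C(E, E)) (hν : ∀ e, p (ν e) = p e) {n : ℕ} {c : K}
  (hνF : ∀ (b : B) (νb : C(↥(p ⁻¹' {b}), ↥(p ⁻¹' {b}))), (∀ e, (νb e : E) = ν e) →
    ∀ y : singularHomology K K ↥(p ⁻¹' {b}) n, singularHomology.map K K νb n y = c • y)

include hp hν hνF in
/-- The theorem over one piece `C ⊆ B` of the base with a CW model without cells of dimension `> 1`, for the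
restricted Serre fibration `p| : p⁻¹C → C` and any restriction `νC` of `ν` to `p⁻¹C`: `νC_* α - c·α` is a sum of
classes of fibres over `C`. [cite: Spanier1981, Ch. 9, Sec. 2, Thm. 17] [cite: HatcherAT2002, §2.2 pp. 149–150] -/
theorem sub_smul_mem_piece_of_cells_le_one (C : Set B) {X : Type u} [TopologicalSpace X] [T2Space X]
    [CWComplex (univ : Set X)] (h1 : ∀ m, 1 < m → IsEmpty (cell (univ : Set X) m))
    (h : C(X, ↥C)) (hh : IsWeakHomotopyEquiv h) (νC : C(↥(p ⁻¹' C), ↥(p ⁻¹' C))) (hνC : ∀ e, (νC e : E) = ν e)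
    (α : singularHomology K K ↥(p ⁻¹' C) (n + 1)) :
    singularHomology.map K K νC (n + 1) α - c • α ∈
      ⨆ b : ↥C, LinearMap.range (singularHomology.map K K
        (subsetInclusion (fibre_subset_preimage b.2 : p ⁻¹' {(b : B)} ⊆ p ⁻¹' C)) (n + 1)).hom := by
  have hpC : IsSerreFibration (C.restrictPreimage p) := hp.restrictPreimage C
  -- the fibres of `p|` are the fibres of `p`
  obtain ⟨e, he⟩ : ∃ e : ∀ x : ↥C, ↥((C.restrictPreimage p) ⁻¹' {x}) ≃ₜ ↥(p ⁻¹' {(x : B)}),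
      ∀ (x : ↥C) (u : ↥((C.restrictPreimage p) ⁻¹' {x})), ((e x u : ↥(p ⁻¹' {(x : B)})) : E) = u.1.1 :=
    ⟨fun x =>
      { toFun := fun u => ⟨u.1.1, congrArg Subtype.val u.2⟩
        invFun := fun v =>
          ⟨⟨v.1, Set.mem_preimage.2 (mem_of_eq_of_mem (v.2 : p v.1 = (x : B)) x.2)⟩, Subtype.ext v.2⟩
        left_inv := fun u => rfl
        right_inv := fun v => rfl
        continuous_toFun := (continuous_subtype_val.comp continuous_subtype_val).subtype_mk _
        continuous_invFun := (continuous_subtype_val.subtype_mk _).subtype_mk _ }, fun x u => rfl⟩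
  have hνC' : ∀ u, (C.restrictPreimage p) (νC u) = (C.restrictPreimage p) u := fun u => by
    apply Subtype.ext
    change p (νC u : E) = p (u : E)
    rw [hνC, hν]
  -- the fibre hypothesis for `p|`
  have hνFC : ∀ (x : ↥C) (νx : C(↥((C.restrictPreimage p) ⁻¹' {x}), ↥((C.restrictPreimage p) ⁻¹' {x}))),
      (∀ u, (νx u : ↥(p ⁻¹' C)) = νC u) →
      ∀ y : singularHomology K K ↥((C.restrictPreimage p) ⁻¹' {x}) n, singularHomology.map K K νx n y = c • y := by
    intro x νx hνx y
    let νb : C(↥(p ⁻¹' {(x : B)}), ↥(p ⁻¹' {(x : B)})) :=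
      ((e x : C(_, ↥(p ⁻¹' {(x : B)}))).comp νx).comp ((e x).symm : C(↥(p ⁻¹' {(x : B)}), _))
    have hνb : ∀ v, (νb v : E) = ν v := fun v => by
      change ((e x (νx ((e x).symm v)) : ↥(p ⁻¹' {(x : B)})) : E) = ν v
      rw [he x, hνx, hνC]
      have h3 := he x ((e x).symm v)
      rw [Homeomorph.apply_symm_apply] at h3
      rw [← h3]
    refine map_eq_smul_of_homeomorph K (e x) νx νb (fun u => ?_) (hνF (x : B) νb hνb) y
    change e x (νx u) = e x (νx ((e x).symm (e x u)))
    rw [Homeomorph.symm_apply_apply]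
  have key := sub_smul_mem_of_cells_le_one K hpC νC hνC' hνFC h hh h1 α
  refine Submodule.iSup_induction
    (p := fun x : ↥C => LinearMap.range (singularHomology.map K K (subsetIncl ((C.restrictPreimage p) ⁻¹' {x})) (n + 1)).hom)
    (motive := fun w => w ∈ ⨆ b : ↥C, LinearMap.range (singularHomology.map K K
      (subsetInclusion (fibre_subset_preimage b.2 : p ⁻¹' {(b : B)} ⊆ p ⁻¹' C)) (n + 1)).hom) key ?_ ?_ ?_
  · rintro x w ⟨y, rfl⟩
    refine Submodule.mem_iSup_of_mem x ⟨singularHomology.map K K (e x : C(_, ↥(p ⁻¹' {(x : B)}))) (n + 1) y, ?_⟩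
    have hfac : (subsetInclusion (fibre_subset_preimage x.2 : p ⁻¹' {(x : B)} ⊆ p ⁻¹' C)).comp
        (e x : C(_, ↥(p ⁻¹' {(x : B)}))) = subsetIncl ((C.restrictPreimage p) ⁻¹' {x}) :=
      ContinuousMap.ext fun u => Subtype.ext (he x u)
    change singularHomology.map K K (subsetInclusion (fibre_subset_preimage x.2 : p ⁻¹' {(x : B)} ⊆ p ⁻¹' C)) (n + 1)
      (singularHomology.map K K (e x : C(_, ↥(p ⁻¹' {(x : B)}))) (n + 1) y) = _
    rw [← ModuleCat.comp_apply, ← singularHomology.map_comp, hfac]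
  · exact Submodule.zero_mem _
  · intro w w' hw hw'
    exact Submodule.add_mem _ hw hw'

end Piece

/-! ### Over a base exhausted by open sets inside pieces with such CW models -/

section Exhaustion

variable (K : Type u) [Field K]
variable {B : Type u} [TopologicalSpace B] {E : Type u} [TopologicalSpace E] {p : E → B}
  (hp : IsSerreFibration p) (ν : C(E, E)) (hν : ∀ e, p (ν e) = p e) {n : ℕ} {c : K}

include hp hν in
/-- **Over an exhausted base, a map over the base acting as `c` on `Hₙ` of every fibre acts as `c` on `H_{n+1}(E)`
modulo classes of fibres.** Let `B = ⋃ₘ Vₘ` be an increasing union of open sets with `Vₘ ⊆ Mₘ` for sub-bases `Mₘ` each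
weakly equivalent to a Hausdorff CW complex without cells of dimension `> 1` (e.g. the complex points of a smooth affine
curve: Andreotti–Frankel). A class `α ∈ H_{n+1}(E)` comes from some `p⁻¹Vₘ ⊆ p⁻¹Mₘ` (compact supports, Hatcher Prop. 3.33),
where the piece theorem applies. [cite: HatcherAT2002, Prop. 3.33 and §2.2 pp. 149–150] [cite: Spanier1981, Ch. 9, Sec. 2, Thm. 17] -/
theorem sub_smul_mem_of_exhaustion
    (hνF : ∀ (b : B) (νb : C(↥(p ⁻¹' {b}), ↥(p ⁻¹' {b}))), (∀ e, (νb e : E) = ν e) →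
      ∀ y : singularHomology K K ↥(p ⁻¹' {b}) n, singularHomology.map K K νb n y = c • y)
    (V : ℕ → Set B) (hVo : ∀ m, IsOpen (V m))
    (hVm : Monotone V) (hV : ⋃ m, V m = univ) (M : ℕ → Set B) (hVM : ∀ m, V m ⊆ M m)
    (hCW : ∀ m, ∃ (X : Type u) (_ : TopologicalSpace X) (_ : T2Space X)
      (_ : CWComplex (univ : Set X)), (∀ k, 1 < k → IsEmpty (cell (univ : Set X) k)) ∧
        ∃ h : C(X, ↥(M m)), IsWeakHomotopyEquiv h)
    (α : singularHomology K K E (n + 1)) :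
    singularHomology.map K K ν (n + 1) α - c • α ∈
      ⨆ b : B, LinearMap.range (singularHomology.map K K (subsetIncl (p ⁻¹' {b})) (n + 1)).hom := by
  -- the open exhaustion `W m = p⁻¹Vₘ` of `E`
  let W : ℕ → Set E := fun m => p ⁻¹' V m
  have hWo : ∀ m, IsOpen (W m) := fun m => (hVo m).preimage hp.continuous
  have hWm : Monotone W := fun i j hij => preimage_mono (hVm hij)
  have hWu : ⋃ m, W m = univ := by
    rw [← preimage_iUnion, hV, preimage_univ]
  -- `α` read on `↥univ` comes from some `W m`
  let u : C(E, ↥(univ : Set E)) := ((Homeomorph.Set.univ E).symm : C(E, ↥(univ : Set E)))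
  have hu : (subsetIncl (univ : Set E)).comp u = ContinuousMap.id E := ContinuousMap.ext fun _ => rfl
  obtain ⟨m, γ', hγ'⟩ := singularHomology.exists_eq_map_of_iUnion W hWo hWm hWu (n + 1)
    (singularHomology.map K K u (n + 1) α)
  have hα : α = singularHomology.map K K (subsetIncl (W m)) (n + 1) γ' := by
    have hfac : (subsetIncl (univ : Set E)).comp (subsetInclusion (hWu ▸ subset_iUnion W m : W m ⊆ univ)) =
        subsetIncl (W m) := ContinuousMap.ext fun _ => rfl
    rw [← hfac, singularHomology.map_comp, ModuleCat.comp_apply, hγ', ← ModuleCat.comp_apply,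
      ← singularHomology.map_comp, hu, singularHomology.map_id]
    rfl
  -- over the piece `C = M m`
  set C : Set B := M m with hC
  have hWC : W m ⊆ p ⁻¹' C := preimage_mono (hVM m)
  set αC : singularHomology K K ↥(p ⁻¹' C) (n + 1) := singularHomology.map K K (subsetInclusion hWC) (n + 1) γ' with hαC
  have hαC' : α = singularHomology.map K K (subsetIncl (p ⁻¹' C)) (n + 1) αC := by
    rw [hα, hαC, ← ModuleCat.comp_apply, ← singularHomology.map_comp]
    rfl
  have hmem : ∀ e : ↥(p ⁻¹' C), ν e ∈ p ⁻¹' C := fun e => by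
    show p (ν e.1) ∈ C; rw [hν]; exact e.2
  let νC : C(↥(p ⁻¹' C), ↥(p ⁻¹' C)) := ⟨fun e => ⟨ν e, hmem e⟩, (ν.continuous.comp continuous_subtype_val).subtype_mk hmem⟩
  have hνCfac : (subsetIncl (p ⁻¹' C)).comp νC = ν.comp (subsetIncl (p ⁻¹' C)) := ContinuousMap.ext fun _ => rfl
  have hpush : singularHomology.map K K ν (n + 1) α - c • α = singularHomology.map K K (subsetIncl (p ⁻¹' C)) (n + 1)
      (singularHomology.map K K νC (n + 1) αC - c • αC) := by
    rw [map_sub, map_smul, ← ModuleCat.comp_apply, ← singularHomology.map_comp, hνCfac, singularHomology.map_comp,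
      ModuleCat.comp_apply, ← hαC']
  obtain ⟨X, _, _, _, h1, h, hh⟩ := hCW m
  have key := sub_smul_mem_piece_of_cells_le_one K hp ν hν hνF C h1 h hh νC (fun _ => rfl) αC
  rw [hpush]
  refine Submodule.iSup_induction
    (p := fun b : ↥C => LinearMap.range (singularHomology.map K K
      (subsetInclusion (fibre_subset_preimage b.2 : p ⁻¹' {(b : B)} ⊆ p ⁻¹' C)) (n + 1)).hom)
    (motive := fun w => singularHomology.map K K (subsetIncl (p ⁻¹' C)) (n + 1) w ∈
      ⨆ b : B, LinearMap.range (singularHomology.map K K (subsetIncl (p ⁻¹' {b})) (n + 1)).hom) key ?_ ?_ ?_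
  · rintro b w ⟨y, rfl⟩
    refine Submodule.mem_iSup_of_mem (b : B) ⟨y, ?_⟩
    change singularHomology.map K K (subsetIncl (p ⁻¹' {(b : B)})) (n + 1) y =
      singularHomology.map K K (subsetIncl (p ⁻¹' C)) (n + 1) (singularHomology.map K K
        (subsetInclusion (fibre_subset_preimage b.2 : p ⁻¹' {(b : B)} ⊆ p ⁻¹' C)) (n + 1) y)
    rw [← ModuleCat.comp_apply, ← singularHomology.map_comp]
    rfl
  · rw [map_zero]; exact Submodule.zero_mem _
  · intro w w' hw hw'
    rw [map_add]; exact Submodule.add_mem _ hw hw'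

/-! ### The cohomological form: `ν^*` acts as `c` on the classes vanishing on every fibre -/

/-- Transport of "`ν^*` is the scalar `c` on `Hᵏ`" along a homeomorphism intertwining two self-maps (a homeomorphism
induces isomorphisms on singular cohomology, functorially). [cite: HatcherAT2002, §2.1 Cor. 2.11 and §3.1 p. 201] -/
theorem cohomologyMap_eq_smul_of_homeomorph {F F' : Type u} [TopologicalSpace F] [TopologicalSpace F'] (φ : F' ≃ₜ F)
    (ν' : C(F', F')) (νF : C(F, F)) (hφ : ∀ e, φ (ν' e) = νF (φ e)) {k : ℕ} {c' : K}
    (h : ∀ a : singularCohomology K K F k, singularCohomology.map K K νF k a = c' • a)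
    (a' : singularCohomology K K F' k) : singularCohomology.map K K ν' k a' = c' • a' := by
  obtain ⟨a, rfl⟩ := (bijective_cohomologyMap_homeomorph K φ k).2 a'
  have hfac : (φ : C(F', F)).comp ν' = νF.comp (φ : C(F', F)) := ContinuousMap.ext hφ
  rw [← ModuleCat.comp_apply, ← singularCohomology.map_comp, hfac, singularCohomology.map_comp, ModuleCat.comp_apply,
    h, map_smul]

/-- Over a field, "`ν_*` is `c` on `Hₙ`" follows from "`ν^*` is `c` on `Hⁿ`" (the Kronecker map
`Hⁿ → Hom(Hₙ, K)` is onto, so functionals `⟨a, ·⟩` separate `Hₙ`). [cite: HatcherAT2002, §3.1 Thm. 3.2 (p. 198) and p. 201] -/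
theorem homologyMap_eq_smul_of_cohomologyMap_eq_smul {F : Type u} [TopologicalSpace F] (νF : C(F, F)) {k : ℕ} {c' : K}
    (h : ∀ a : singularCohomology K K F k, singularCohomology.map K K νF k a = c' • a)
    (y : singularHomology K K F k) : singularHomology.map K K νF k y = c' • y := by
  rw [← sub_eq_zero, ← Module.forall_dual_apply_eq_zero_iff K]
  intro l
  obtain ⟨a, rfl⟩ := (kroneckerPairing_bijective_of_field K F k).2 l
  rw [map_sub, map_smul, ← kroneckerPairing_map, h, map_smul, LinearMap.smul_apply, sub_self]

include hp hν in
/-- **COHOMOLOGICAL FORM.** Let `p : E → B` be a Serre fibration over a base exhausted as in `sub_smul_mem_of_exhaustion`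
(e.g. the complex points of a smooth affine curve), `K` a field, `ν : E → E` a map over `B` with `ν^* = c` on `Hⁿ(p⁻¹b; K)`
for every `b`. Then **`ν^* z = c·z` for every `z ∈ H^{n+1}(E; K)` vanishing on every fibre** — the action of `ν` on the
middle Leray piece `L¹H^{n+1} = H¹(B; Rⁿ p_* K)` is the scalar by which it acts on the coefficients (Kronecker duality:
`⟨ν^*z - cz, α⟩ = ⟨z, ν_*α - cα⟩ = 0` since `ν_*α - cα` is a sum of classes of fibres).
[cite: VoisinHodgeII2003, §4.2.3 and Thm. 4.15] [cite: HatcherAT2002, §3.1 Thm. 3.2 (p. 198) and p. 201] -/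
theorem map_eq_smul_of_forall_res_eq_zero_of_exhaustion
    (hνF : ∀ (b : B) (νb : C(↥(p ⁻¹' {b}), ↥(p ⁻¹' {b}))), (∀ e, (νb e : E) = ν e) →
      ∀ a : singularCohomology K K ↥(p ⁻¹' {b}) n, singularCohomology.map K K νb n a = c • a)
    (V : ℕ → Set B) (hVo : ∀ m, IsOpen (V m))
    (hVm : Monotone V) (hV : ⋃ m, V m = univ) (M : ℕ → Set B) (hVM : ∀ m, V m ⊆ M m)
    (hCW : ∀ m, ∃ (X : Type u) (_ : TopologicalSpace X) (_ : T2Space X)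
      (_ : CWComplex (univ : Set X)), (∀ k, 1 < k → IsEmpty (cell (univ : Set X) k)) ∧
        ∃ h : C(X, ↥(M m)), IsWeakHomotopyEquiv h)
    (z : singularCohomology K K E (n + 1))
    (hz : ∀ b : B, singularCohomology.map K K (subsetIncl (p ⁻¹' {b})) (n + 1) z = 0) :
    singularCohomology.map K K ν (n + 1) z = c • z := by
  have hνF' : ∀ (b : B) (νb : C(↥(p ⁻¹' {b}), ↥(p ⁻¹' {b}))), (∀ e, (νb e : E) = ν e) →
      ∀ y : singularHomology K K ↥(p ⁻¹' {b}) n, singularHomology.map K K νb n y = c • y :=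
    fun b νb hνb y => homologyMap_eq_smul_of_cohomologyMap_eq_smul K νb (hνF b νb hνb) y
  rw [← sub_eq_zero]
  apply (kroneckerPairing_bijective_of_field K E (n + 1)).1
  rw [map_zero]
  refine LinearMap.ext fun α => ?_
  rw [LinearMap.zero_apply, map_sub, map_smul, LinearMap.sub_apply, LinearMap.smul_apply, kroneckerPairing_map,
    ← map_smul, ← map_sub]
  have key := sub_smul_mem_of_exhaustion K hp ν hν hνF' V hVo hVm hV M hVM hCW α
  refine Submodule.iSup_induction (p := fun b : B => LinearMap.range (singularHomology.map K K (subsetIncl (p ⁻¹' {b})) (n + 1)).hom)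
    (motive := fun w => kroneckerPairing K K E (n + 1) z w = 0) key ?_ ?_ ?_
  · rintro b w ⟨y, rfl⟩
    change kroneckerPairing K K E (n + 1) z (singularHomology.map K K (subsetIncl (p ⁻¹' {b})) (n + 1) y) = 0
    rw [← kroneckerPairing_map, hz b, map_zero, LinearMap.zero_apply]
  · exact map_zero _
  · intro w w' hw hw'
    rw [map_add, hw, hw', add_zero]

end Exhaustion

end SerreFibrewiseScalar

end Literature.AlgebraicTopology.Homotopy

end
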